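import Summits.FinalStateConjecture.FinalStateConjecture.Theses.BartnikGapSettling
import Summits.FinalStateConjecture.FinalStateConjecture.Theorems.GenericCensorshipCollarMargin.Negative.GenericCensorshipCollarMarginFalseOfExtremalJunkCollars

/-!
# `TameCensorshipCollarMargin` (stmt-FinalStateConjecture-17329) — negative side:
# the tame re-type inherits the 10809 misstatement (junk collars kill the crux as filed)

Route `BartnikGapSettling`, crux `TameCensorshipCollarMargin` = item 10809
(`GenericCensorshipCollarMargin`, closed moot at the T2 route repair) with ONE token changed,
`InitialDataSet.IsChristodoulouGeneric ↦ InitialDataSet.IsTameChristodoulouGeneric`; the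
collar-margin conjunct was re-filed VERBATIM: `∃ χ₁ < 1, k₁, δ₁ > 0, K₁ compact, ∀ M₁ a₁ mo₁ B₁ Φ₁,
0 < M₁ → |a₁| ≤ M₁ → … → |a₁| ≤ χ₁ M₁` — thick collar charts of UNBOUNDED label `M₁` (and boost) at
ONE unweighted `Cᵏ` tolerance. By degree-`0` homogeneity of Kerr–Schild (`∂ᵐ` of a chart rescaled by
`M₁` carries `M₁^{-m}`) and the Lorentzian one-sided Nash–Kuiper theorem (A. Boukholkhal,
arXiv:2407.19333v2, Thm. 1.2 / Prop. 3.1; free transverse `1`-jet for lapse and shift), every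
spacetime with arbitrarily large near-flat regions beyond each `J⁻(K₁)` — Minkowski space, the far
field of every admissible MGHD — is expected to carry EXTREMAL-label (`a₁ = M₁ → ∞`) thick collar
charts at every tolerance, so the conjunct fails there for reasons unrelated to censorship or to the
third law. That construction is the hypothesis `ExtremalJunkCollars` of the sibling Negative module
(p103863, not constructible in the tree today: convex integration + far-field Cauchy stability).

This file records, as pure logic over the filed text of item 17329 (refuter crux-attack vetting,
2026-08-17), the three layers of the kill:

* `TameCensorshipCollarMargin_false_of_forall_exceptional` — the INTERFACE between constructions and
  `¬ TameCensorshipCollarMargin`: if on ONE `3`-manifold `X` with a non-empty admissible class every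
  admissible datum is exceptional (some MGHD lacks complete `𝓘⁺` or the collar margin), the crux
  fails — a tame-generic property must hold at the `c ≠ 0` members of an admissible witness family,
  and those members are admissible data on the same `X`.
* `TameCensorshipCollarMargin_false_of_junkClass` — the `X`-local junk form: it suffices that every
  admissible datum on such an `X` has SOME maximal development carrying, at every tolerance
  `(k₁, δ₁, K₁)`, an extremal-label thick collar chart meeting the clause's hypotheses verbatim
  (`not_collarMarginClause_of_junk` of the sibling module does the arithmetic `|M₁| ≤ χ₁ M₁ < M₁`).
* `TameCensorshipCollarMargin_false_of_ExtremalJunkCollars` —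
  `ExtremalJunkCollars → MGHDExists → ¬ TameCensorshipCollarMargin`, the named-hypothesis corollary on
  `X = Minkowski.slice ≅ ℝ³` (`trivialData_mem_admissibleVacuumData`), with the route's own crux
  `MGHDExists` (stmt-FinalStateConjecture-9937, Choquet-Bruhat–Geroch) supplying the developments.
  (The same implication is kernel-checked inside the crux skeleton `Cruxes/TameCensorshipCollarMargin/
  Lines/birth.lean` §3 via `IsTameChristodoulouGeneric.isChristodoulouGeneric`; here it is proved
  directly on the tame notion and filed on the Negative lane so that the item is held for restatement.)

Verdict carried: MISSTATED (by inheritance). Repair converged over the 10809/10808 leads (C‴₂,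
`Cruxes/GenericCensorshipCollarMargin/RestatementProbeC3.lean`, `VERDICT-c3.md`): window the label
`∀ m₀ > 0 … m₀ ≤ M₁ ≤ m₀⁻¹` and the boost `max ‖Λ‖ ‖Λ⁻¹‖ ≤ ρ₀` BEFORE choosing `(χ₁, δ₁, K₁)`, order
`k₁ := 2`; the junk family (labels `→ ∞`) is then not an instance, and nothing here bears on the
repaired statement. No unconditional `¬ TameCensorshipCollarMargin` is available: every exceptional
datum needs a development proved MAXIMAL in the tree's typing (CBG uniqueness, unproved tree fact
`choquetBruhat_geroch_exists_mghd_cauchy`).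
-/

noncomputable section

-- D-0017: single-problem summit, `Summit.<S>.<S>.…` by design (cf. lakefile `weak.linter.dupNamespace`).
set_option linter.dupNamespace false

open Set
open scoped Manifold ENNReal ContDiff Topology

namespace Summit.FinalStateConjecture.FinalStateConjecture.Theorems.TameCensorshipCollarMargin.Negative

open Literature.Geometry.Lorentzian
open Summit.FinalStateConjecture.FinalStateConjecture.Theses.BartnikGapSettling
  (TameCensorshipCollarMargin MGHDExists)
open Summit.FinalStateConjecture.FinalStateConjecture.Theorems.GenericCensorshipCollarMargin.Negative
  (ExtremalJunkCollars not_collarMarginClause_of_junk)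

/-- **Interface lemma: one everywhere-exceptional admissible class kills the crux.** If on some
connected Hausdorff second-countable `3`-manifold `X` the admissible class is non-empty and EVERY
admissible datum fails the crux property (some maximal vacuum Cauchy development lacks complete
`𝓘⁺` or the collar-margin clause), then `TameCensorshipCollarMargin` is false: the tame-generic
escape clause would make the parameter-`c ≠ 0` members of an admissible witness family through an
exceptional datum good, but they are admissible data on `X`, hence exceptional. [folklore] -/
theorem TameCensorshipCollarMargin_false_of_forall_exceptional
    (X : Type) [TopologicalSpace X] [ChartedSpace E3 X]
    [IsManifold (𝓡 3) ((⊤ : ℕ∞) : WithTop ℕ∞) X] [T2Space X] [SecondCountableTopology X]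
    [ConnectedSpace X]
    (hne : (admissibleVacuumData X).Nonempty)
    (hexc : ∀ D ∈ admissibleVacuumData X, ¬ (∀ 𝒟 : VacuumCauchyDevelopment D, 𝒟.IsMaximal → Summit.FinalStateConjecture.HasCompleteNullInfinity 𝒟.toCauchyDevelopment ∧ (∃ (χ₁ : ℝ) (k₁ : ℕ) (δ₁ : ENNReal) (K₁ : Set 𝒟.carrier), χ₁ < 1 ∧ 0 < δ₁ ∧ IsCompact K₁ ∧ ∀ (M₁ a₁ : ℝ) (mo₁ : lorentzGroup × E4) (B₁ : ModelBackground) (Φ₁ : B₁.domain → 𝒟.carrier), 0 < M₁ → |a₁| ≤ M₁ → B₁ = starBackground mo₁.1 mo₁.2 M₁ a₁ (fun x => Kerr.radius a₁ (poincareInv mo₁.1 mo₁.2 x)) → ContMDiffOn 𝓘(ℝ, E4) (𝓡 4) ((⊤ : ℕ∞) : WithTop ℕ∞) Φ₁ {x | -1 < B₁.time x.1 ∧ B₁.time x.1 < 1 ∧ B₁.radius x.1 < 3 * M₁ + 1} → Topology.IsOpenEmbedding ({x | -1 < B₁.time x.1 ∧ B₁.time x.1 < 1 ∧ B₁.radius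 x.1 < 3 * M₁ + 1}.restrict Φ₁) → 𝒟.toSpacetime.truncDeviationCk B₁ Φ₁ k₁ (3 * M₁) 0 ≤ δ₁ → Disjoint (Φ₁ '' B₁.truncTimeSlab (3 * M₁) 0) (𝒟.metric.causalPast 𝒟.timeOrientation K₁) → |a₁| ≤ χ₁ * M₁))) :
    ¬ TameCensorshipCollarMargin := by
  intro hT
  obtain ⟨d, hd⟩ := hne
  obtain ⟨e, F, -, -, -, -, hF𝓓, hFE⟩ := hT X d ⟨hd, hexc d hd⟩
  obtain ⟨c, hc⟩ := exists_ne (0 : EuclideanSpace ℝ (Fin 1))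
  exact hFE c hc ⟨hF𝓓 c, hexc (F c) (hF𝓓 c)⟩

/-- **`X`-local junk form.** If on some `3`-manifold `X` with a non-empty admissible class every
admissible datum has SOME maximal vacuum Cauchy development carrying, for every order `k₁`, size
`0 < δ₁` and compact `K₁`, a thick collar chart of EXTREMAL label `(M₁, a₁ = M₁)`, `0 < M₁`, on the
boosted Kerr star background, smooth on and an open embedding of the collar layer, `δ₁`-close in
`C^{k₁}` to boosted Kerr on the thick slab and with slab image disjoint from `J⁻(K₁)` — i.e. meeting
every hypothesis of the filed collar-margin clause with `|a₁| = M₁` — then `TameCensorshipCollarMargin`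
is false (`|M₁| ≤ χ₁ M₁ < M₁`, `not_collarMarginClause_of_junk`). Expected instance: `X = ℝ³`, far-field
junk collars of labels `M₁ → ∞` (Boukholkhal arXiv:2407.19333v2 Thm 1.2; degree-`0` homogeneity of
Kerr–Schild). [folklore] -/
theorem TameCensorshipCollarMargin_false_of_junkClass
    (X : Type) [TopologicalSpace X] [ChartedSpace E3 X]
    [IsManifold (𝓡 3) ((⊤ : ℕ∞) : WithTop ℕ∞) X] [T2Space X] [SecondCountableTopology X]
    [ConnectedSpace X]
    (hne : (admissibleVacuumData X).Nonempty)
    (hJ : ∀ D ∈ admissibleVacuumData X, ∃ 𝒟 : VacuumCauchyDevelopment D, 𝒟.IsMaximal ∧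
          ∀ (k₁ : ℕ) (δ₁ : ENNReal) (K₁ : Set 𝒟.carrier), 0 < δ₁ → IsCompact K₁ →
            ∃ (M₁ : ℝ) (mo₁ : lorentzGroup × E4) (B₁ : ModelBackground)
              (Φ₁ : B₁.domain → 𝒟.carrier),
              0 < M₁ ∧
              B₁ = starBackground mo₁.1 mo₁.2 M₁ M₁
                (fun x => Kerr.radius M₁ (poincareInv mo₁.1 mo₁.2 x)) ∧
              ContMDiffOn 𝓘(ℝ, E4) (𝓡 4) ((⊤ : ℕ∞) : WithTop ℕ∞) Φ₁
                {x | -1 < B₁.time x.1 ∧ B₁.time x.1 < 1 ∧ B₁.radius x.1 < 3 * M₁ + 1} ∧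
              Topology.IsOpenEmbedding
                ({x | -1 < B₁.time x.1 ∧ B₁.time x.1 < 1 ∧ B₁.radius x.1 < 3 * M₁ + 1}.restrict Φ₁) ∧
              𝒟.toSpacetime.truncDeviationCk B₁ Φ₁ k₁ (3 * M₁) 0 ≤ δ₁ ∧
              Disjoint (Φ₁ '' B₁.truncTimeSlab (3 * M₁) 0)
                (𝒟.metric.causalPast 𝒟.timeOrientation K₁)) :
    ¬ TameCensorshipCollarMargin := by
  refine TameCensorshipCollarMargin_false_of_forall_exceptional X hne ?_
  intro D hD hPD
  obtain ⟨𝒟, hmax, hjunk⟩ := hJ D hD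
  exact not_collarMarginClause_of_junk 𝒟 hjunk (hPD 𝒟 hmax).2

/-- **The filed crux is false modulo junk collars and MGHD existence** (negative lemma modulo
`ExtremalJunkCollars`; the tame re-type of p103863's
`GenericCensorshipCollarMargin_false_of_ExtremalJunkCollars`). Under `ExtremalJunkCollars` (every MGHD
of every admissible datum carries extremal-label junk collars at every tolerance — expected true,
not constructible in the tree) and the route's crux `MGHDExists` (stmt-FinalStateConjecture-9937),
the admissible class of the Minkowski slice `Minkowski.slice ≅ ℝ³` — non-empty by
`trivialData_mem_admissibleVacuumData` — is everywhere exceptional, so `TameCensorshipCollarMargin`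
fails. Verdict MISSTATED (by inheritance from item 10809); repair: window label and boost (C‴₂).
Nothing here bears on weak cosmic censorship or on the third law. [folklore] -/
theorem TameCensorshipCollarMargin_false_of_ExtremalJunkCollars :
    ExtremalJunkCollars → MGHDExists → ¬ TameCensorshipCollarMargin := by
  intro hJ hE
  refine TameCensorshipCollarMargin_false_of_junkClass Minkowski.slice
    admissibleVacuumData_slice_nonempty ?_
  intro D hD
  obtain ⟨𝒟, hmax⟩ := hE Minkowski.slice D hD
  exact ⟨𝒟, hmax, hJ Minkowski.slice D hD 𝒟 hmax⟩

end Summit.FinalStateConjecture.FinalStateConjecture.Theorems.TameCensorshipCollarMargin.Negative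

end
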